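import Summits.HodgeConjecture.HodgeConjecture.Theorems.F0P3XiSideOfRecordSC   -- R4-SC B1 (F0P3a-p01 (g11)): `xiSideOfRecordSC`, `hFinU_of_xiLocalPacketUnitarySC` (+ ★ A2 p840437 `xiEvpOfRecordSC`, `xiUnram_xiEvpOfRecordSC`; ★ A1 p840408 `xiPacketFamilyOfRecordSC`; ★ `ramOfRecord₂`; ★ `XiLocalPacketUnitary`)
import HarnessLib

/-!
# Crux `H413`, R4-SC B2 — THE ENDOSCOPIC ANCHOR over the SUPERCUSPIDAL-PARTNER datum `hSC` (SC twin of ★ `F0P3Rung0EndoscopicAnchor`): `OverrideWitness.anchorG ∕ anchorH` AT `Π(ξ)`, `ρ(ξ) = ξ`, from the SC ξ-side of record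

R4-SC B2 (LEAD F0P3a-plan (g9) T8-31 (4): A-p03 (g24) second pen on F0P3a-p01 (g11)'s R4-SC road; branch (α) of the F0P3 desk's D19 ADDENDUM (A)).  TOKEN-FOR-TOKEN
twin of ★ `F0P3Rung0EndoscopicAnchor` with the character-identity binder `hCM` REPLACED by the supercuspidal-partner binder `hSC` (the Q-CM junk repair, T8-21: K0 reads only
`.πs` ∕ `.πs_isSupercuspidal` of the identity, so the honest binder is `∃ πs, πs.IsSupercuspidal ∧ πs ≠ πⁿ`), every head renamed `name ↦ nameSC`, every record constant
`xiEvpOfRecord ∕ xiSideOfRecord ∕ hFinU_of_xiLocalPacketUnitary ∕ xiUnram_xiEvpOfRecord ↦ …SC` (★ A1 p840408, ★ A2 p840437, B1), and the explicit telescope MINUS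
`Δ mH mG νG νH ξloc` (they entered only through `hCM`'s type).  Original docstring follows.


Cell `hodgecm-mathlib`, F0∕P3a, crux H413 (`stmt-HodgeConjecture-24833`); original: F0P3a-p01 (g11) on LEAD F0P3a-plan (g8) WORD T7-9 (Q2 «=») after the census
`F0/P3a/F0P3a-p01/g11/CENSUS-K9-0a-b-EndoscopicData.F0P3a-p01g11.md` (K9-0a(b): the endoscopic DATA of record are already ★ — `xiEvpOfRecord`, `ramOfRecord₂` — so no
definition is filed; this is the one honest ξ-indexed THEOREM next to them).  PROOF lane: theorems only; no `def`, no instance, no notation, no named fact, no `sorry`;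
`--supports stmt-HodgeConjecture-24833`.  Count-neutral.

THE FIELD IT PAYS.  The rung-0 closer's `OverrideWitness` (`Cruxes/H413/Lines/F0_U3LettersRung1.lean` §B) carries, inside the ONE ∃ of `stub_K9`, the PACKET ANCHORS
`anchorG : ∀ Q v, v ∉ S₀ → v ∉ ramG Q → ∃ π : IrrClass (G′_v), π.IsAdmissible ∧ π.IsUnitarizable ∧ π.IsSphericalWith K_v (νG v) (evpG Q v)` (and `anchorH` likewise):
off the level and the packet's ramification, the packet e.v.p. IS the eigencharacter of an admissible UNITARIZABLE `K_v`-spherical class [Rogawski1990 §13.7 p. 210;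
§12.2 (2) pp. 173–174; §13.1 p. 199].  For the ENDOSCOPIC packets `Q = Π(ξ)`, `ρ = ξ` — the only packets the ξ-side of record names — this is a THEOREM of the tree:
* `anchorXi_of_xiLocalPacketUnitarySC` (§1): off `ram₀ ξ := ramOfRecord₂ … ξ (hexc ξ)` and for a Haar family `μv`, the member `πⁿ(ξ_v)` of the packet of record
  (★ `xiPacketFamilyOfRecord … ξ v`) is admissible, `K_v`-spherical WITH the ξ-side e.v.p. of record `tXi₀ ξ v := xiEvpOfRecord … μv ξ v` (★ row #21
  `xiUnram_xiEvpOfRecord`) and UNITARIZABLE (★ `hFinU_of_xiLocalPacketUnitary`, from the letter «XiLocalPacketUnitary», a HYPOTHESIS `hXU` here — on the registry it is the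
  closed stub `stub_XLPU`, itself modulo the theta letter); the same read through the bundle `ξd₀ := xiSideOfRecordSC …` (`anchorXi_xiSideOfRecordSC`);
* `anchorG_at_PiXiSC` ∕ `anchorH_at_ρXiSC` (§2): the PACKET-TYPE-PARAMETRIC corollary — for ANY packet types `PG PH` and ANY (J2) data `evpG evpH ramG ramH PiXi ρXi` whose
  endoscopic values agree with the ξ-side of record off the packet's ramification (`hE : v ∉ ramG (PiXi ξ) → evpG (PiXi ξ) v = ξd₀.tXi ξ v`, `hR : ξd₀.ram ξ ⊆ ramG (PiXi ξ)`;
  resp. `H`), the text of `OverrideWitness.anchorG` (resp. `anchorH`) holds AT `Q = PiXi ξ` (resp. `ρ = ρXi ξ`) token for token (the level guard `v ∉ S₀` is not even needed).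
HONEST VALUE: this pays the anchors on the endoscopic image of `PiXi ∕ ρXi` only; at the STABLE packets (`Q ∉ range PiXi`) the anchors remain print [§13.7 p. 210: the
members of a global packet are unitary and almost everywhere unramified] inside the full-spectrum letter «K9-STF» (F0P3-plan desk 2026-08-31T23:53:32Z (ii)).

References: [Rogawski1990] §12.2 (1)–(2) pp. 173–174, §13.1 p. 199, §13.7 p. 210, §14.6 Thm. 14.6.1 p. 241; [CartierCorvallis1979] §IV.1 Cor. 4.1–4.2; [Langlands1980] p. 209.
HC_CM is proved only modulo the printed citations until rung 0 closes.
-/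

set_option autoImplicit false
set_option linter.dupNamespace false

noncomputable section

open NumberField IsDedekindDomain MeasureTheory
open Literature.NumberTheory.Rogawski1990 Literature.NumberTheory.GaloisRepresentations
open Literature.NumberTheory.Automorphic Literature.NumberTheory.Automorphic.UnitaryGroup
open scoped Matrix

namespace Summit.HodgeConjecture.HodgeConjecture.Cruxes.H413.F0P3Rung0EndoscopicAnchorSC

open Summit.HodgeConjecture.HodgeConjecture.Cruxes.H413.F0P3InnerFormClassificationV6
open Summit.HodgeConjecture.HodgeConjecture.Cruxes.H413.F0P3XiPacketFamilyOfRecord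
open Summit.HodgeConjecture.HodgeConjecture.Cruxes.H413.F0P3XiPacketFamilyOfRecordSC
open Summit.HodgeConjecture.HodgeConjecture.Cruxes.H413.F0P3XiSideOfRecordSC (xiSideOfRecordSC hFinU_of_xiLocalPacketUnitarySC)
open Summit.HodgeConjecture.HodgeConjecture.Cruxes.H413.F0P3LettersXiLocalPacketUnitary (XiLocalPacketUnitary)

variable (L : Type) [Field L] [NumberField L] [IsCMField L] (H : Matrix (Fin 3) (Fin 3) L)
  (hH : (H.map (cmConjRingHom L))ᵀ = H) (hHd : IsUnit H.det) (μω : HeckeCharacter L) (hμu : μω.IsUnitary)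
  [∀ v : HeightOneSpectrum (𝓞 ↥(maximalRealSubfield L)), MeasurableSpace (Gqs L v ⧸ Subgroup.center (Gqs L v))]
  (μZ : ∀ v : HeightOneSpectrum (𝓞 ↥(maximalRealSubfield L)), Measure (Gqs L v ⧸ Subgroup.center (Gqs L v)))
  (keys : ∀ (ξ : OneDimAutRepH L) (v : HeightOneSpectrum (𝓞 ↥(maximalRealSubfield L))),
    (∀ w : PlacesOver L v, IsCMField.complexConj L • w.1 = w.1) →
      {p : IrrClass (Gqs L v) × IrrClass (Gqs L v) //
        KeysCaseTwoLabels L v (μω.semilocalComponent L v) (torusLocalComponent L (IsCMField.complexConj L) v ξ.η)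
          (torusLocalComponent L (IsCMField.complexConj L) v ξ.ψ) p.1 p.2 ∧
        p.1.IsSquareIntegrable (μZ v) ∧ ¬ p.2.IsSquareIntegrable (μZ v)})
  (hSC : letI : ∀ v : HeightOneSpectrum (𝓞 ↥(maximalRealSubfield L)), MeasurableSpace ((cmDatum L 3 H).Local v) := fun _ => borel _
    ∀ (ξ : OneDimAutRepH L) (v : HeightOneSpectrum (𝓞 ↥(maximalRealSubfield L)))
    (hns : ∀ w : PlacesOver L v, IsCMField.complexConj L • w.1 = w.1)
    (T : GL (Fin 3) (LocalRing L v)) (a : LocalRing L v) (ha : IsUnit a)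
    (h : formCongr (conjLocal L (IsCMField.complexConj L) v) T (H.map (algebraMap L (LocalRing L v))) =
      a • (Matrix.of fun i j : Fin 3 => if i.val + j.val + 1 = 3 then (1 : L) else 0).map (algebraMap L (LocalRing L v)))
    (π2 πn : IrrClass (Gqs L v)),
    KeysCaseTwoLabels L v (μω.semilocalComponent L v) (torusLocalComponent L (IsCMField.complexConj L) v ξ.η)
      (torusLocalComponent L (IsCMField.complexConj L) v ξ.ψ) π2 πn → ¬ πn.IsSquareIntegrable (μZ v) →
    ∃ πs : IrrClass ((cmDatum L 3 H).Local v), πs.IsSupercuspidal ∧ πs ≠ IrrClass.comap (cmDatumLocalCongr L v T ha h).symm πn)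
  (hexc : ∀ ξ : OneDimAutRepH L, ∀ᶠ v : HeightOneSpectrum (𝓞 ↥(maximalRealSubfield L)) in Filter.cofinite,
      ∀ hns : ∀ w : PlacesOver L v, IsCMField.complexConj L • w.1 = w.1,
        ((keys ξ v hns).1.2).IsSpherical (cmLocalIntegralLevel L 3 (qsForm L) v))
  (μv : ∀ v : Places L, @Measure ((cmDatum L 3 H).Local v) (borel _))

/-! ## §1 The anchor at `ξ`: `πⁿ(ξ_v)` of record is admissible, unitarizable and `K_v`-spherical with the ξ-side e.v.p. of record -/

/-- **THE ENDOSCOPIC ANCHOR** (from the letter «XiLocalPacketUnitary» and row #21): off `ram₀ ξ = ramOfRecord₂ … ξ (hexc ξ)`, for a Haar family `μv` on the `G′_v`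
(Borel σ-algebras), there is an admissible UNITARIZABLE class of `G′_v` that is `K_v`-spherical with eigencharacter `tXi₀ ξ v = xiEvpOfRecord … μv ξ v` — namely the
member `πⁿ(ξ_v)` of the packet of record. [cite: Rogawski1990, §12.2 (1)–(2) pp. 173–174; §13.1 p. 199; §13.7 p. 210] [cite: CartierCorvallis1979, §IV.1 Cor. 4.1] -/
theorem anchorXi_of_xiLocalPacketUnitarySC (hXU : XiLocalPacketUnitary L H hH hHd μω hμu μZ keys)
    (hμv : ∀ v : Places L, letI : MeasurableSpace ((cmDatum L 3 H).Local v) := borel _; (μv v).IsHaarMeasure)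
    (ξ : OneDimAutRepH L) (v : Places L) (hv : v ∉ ramOfRecord₂ L H hH hHd μω μZ keys ξ (hexc ξ)) :
    letI : MeasurableSpace ((cmDatum L 3 H).Local v) := borel _
    ∃ π : IrrClass ((cmDatum L 3 H).Local v), π.IsAdmissible ∧ π.IsUnitarizable ∧
      π.IsSphericalWith (cmLocalIntegralLevel L 3 H v) (μv v)
        ((letI : ∀ v : HeightOneSpectrum (𝓞 ↥(maximalRealSubfield L)), MeasurableSpace ((cmDatum L 3 H).Local v) := fun _ => borel _
          xiEvpOfRecordSC L H hH hHd μω hμu μZ keys hSC μv) ξ v) := by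
  letI : ∀ v : HeightOneSpectrum (𝓞 ↥(maximalRealSubfield L)), MeasurableSpace ((cmDatum L 3 H).Local v) := fun _ => borel _
  haveI : BorelSpace ((cmDatum L 3 H).Local v) := ⟨rfl⟩
  haveI : (μv v).IsHaarMeasure := hμv v
  obtain ⟨hsph, hadm⟩ := xiUnram_xiEvpOfRecordSC L H hH hHd μω hμu μZ keys hSC μv ξ v hv
  exact ⟨_, hadm, (hFinU_of_xiLocalPacketUnitarySC L H hH hHd μω hμu μZ keys hSC hXU ξ v).1, hsph⟩

section Bundle

variable {PG PH : Type} (evpG : PG → EvpData L H) (evpH : PH → EvpData L H) (ramG : PG → Finset (Places L)) (ramH : PH → Finset (Places L))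
  (PiXi : OneDimAutRepH L → PG) (ρXi : OneDimAutRepH L → PH)

/-- **The anchor at `ξ`, read through the ξ-side of record `ξd₀ := xiSideOfRecordSC …`** (its `ram ∕ tXi ∕ packFin` are `ramOfRecord₂ ∕ xiEvpOfRecord ∕ xiPacketFamilyOfRecord`
by `rfl`): off `ξd₀.ram ξ`, the class `(ξd₀.packFin ξ v).πn` is admissible, unitarizable and `K_v`-spherical with `ξd₀.tXi ξ v`.
[cite: Rogawski1990, §12.2 (1)–(2) pp. 173–174; §13.1 p. 199; §13.7 p. 210] [cite: CartierCorvallis1979, §IV.1 Cor. 4.1] -/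
theorem anchorXi_xiSideOfRecordSC (hXU : XiLocalPacketUnitary L H hH hHd μω hμu μZ keys)
    (hμv : ∀ v : Places L, letI : MeasurableSpace ((cmDatum L 3 H).Local v) := borel _; (μv v).IsHaarMeasure)
    (ξ : OneDimAutRepH L) (v : Places L)
    (hv : v ∉ (xiSideOfRecordSC L H hH hHd μω hμu μZ keys hSC hexc μv evpG evpH ramG ramH PiXi ρXi).ram ξ) :
    letI : MeasurableSpace ((cmDatum L 3 H).Local v) := borel _
    ((xiSideOfRecordSC L H hH hHd μω hμu μZ keys hSC hexc μv evpG evpH ramG ramH PiXi ρXi).packFin ξ v).πn.IsAdmissible ∧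
      ((xiSideOfRecordSC L H hH hHd μω hμu μZ keys hSC hexc μv evpG evpH ramG ramH PiXi ρXi).packFin ξ v).πn.IsUnitarizable ∧
      ((xiSideOfRecordSC L H hH hHd μω hμu μZ keys hSC hexc μv evpG evpH ramG ramH PiXi ρXi).packFin ξ v).πn.IsSphericalWith
        (cmLocalIntegralLevel L 3 H v) (μv v)
        ((xiSideOfRecordSC L H hH hHd μω hμu μZ keys hSC hexc μv evpG evpH ramG ramH PiXi ρXi).tXi ξ v) := by
  letI : ∀ v : HeightOneSpectrum (𝓞 ↥(maximalRealSubfield L)), MeasurableSpace ((cmDatum L 3 H).Local v) := fun _ => borel _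
  haveI : BorelSpace ((cmDatum L 3 H).Local v) := ⟨rfl⟩
  haveI : (μv v).IsHaarMeasure := hμv v
  obtain ⟨hsph, hadm⟩ := xiUnram_xiEvpOfRecordSC L H hH hHd μω hμu μZ keys hSC μv ξ (hexc := hexc ξ) v hv
  exact ⟨hadm, (hFinU_of_xiLocalPacketUnitarySC L H hH hHd μω hμu μZ keys hSC hXU ξ v).1, hsph⟩

/-! ## §2 The packet-type-parametric corollary: `OverrideWitness.anchorG ∕ anchorH` AT `Q = Π(ξ)`, `ρ = ρ(ξ)` -/

/-- **`anchorG` AT THE ENDOSCOPIC PACKET `Π(ξ)`** — for ANY packet type `PG` and ANY (J2) data `(evpG, ramG, PiXi)` whose values at `Π(ξ)` agree with the ξ-side of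
record off the packet's ramification (`hE`) and whose ramification contains `ram₀ ξ` (`hR`): off `ramG (Π(ξ))` the e.v.p. `evpG (Π(ξ)) v` is the eigencharacter of an
admissible unitarizable `K_v`-spherical class of `G′_v` — the text of the closer's `OverrideWitness.anchorG` at `Q = PiXi ξ` (its level guard `v ∉ S₀` is not needed).
[cite: Rogawski1990, §13.7 p. 210; §12.2 (2) pp. 173–174; §13.1 p. 199] [cite: CartierCorvallis1979, §IV.1 Cor. 4.1–4.2] -/
theorem anchorG_at_PiXiSC (hXU : XiLocalPacketUnitary L H hH hHd μω hμu μZ keys)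
    (hμv : ∀ v : Places L, letI : MeasurableSpace ((cmDatum L 3 H).Local v) := borel _; (μv v).IsHaarMeasure)
    (hE : ∀ (ξ : OneDimAutRepH L) (v : Places L), v ∉ ramG (PiXi ξ) →
      evpG (PiXi ξ) v = (xiSideOfRecordSC L H hH hHd μω hμu μZ keys hSC hexc μv evpG evpH ramG ramH PiXi ρXi).tXi ξ v)
    (hR : ∀ ξ : OneDimAutRepH L, (xiSideOfRecordSC L H hH hHd μω hμu μZ keys hSC hexc μv evpG evpH ramG ramH PiXi ρXi).ram ξ ⊆ ramG (PiXi ξ))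
    (ξ : OneDimAutRepH L) (v : Places L) (hv : v ∉ ramG (PiXi ξ)) :
    letI : MeasurableSpace ((cmDatum L 3 H).Local v) := borel _
    ∃ π : IrrClass ((cmDatum L 3 H).Local v), π.IsAdmissible ∧ π.IsUnitarizable ∧
      π.IsSphericalWith (cmLocalIntegralLevel L 3 H v) (μv v) (evpG (PiXi ξ) v) := by
  rw [hE ξ v hv]
  exact ⟨_, anchorXi_xiSideOfRecordSC L H hH hHd μω hμu μZ keys hSC hexc μv evpG evpH ramG ramH PiXi ρXi hXU hμv ξ v
    (fun h => hv (hR ξ h))⟩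

/-- **`anchorH` AT THE ENDOSCOPIC PACKET `ρ(ξ) = ξ`** — the `H`-side twin: for ANY `PH` and ANY `(evpH, ramH, ρXi)` with `evpH (ρ(ξ)) v = tXi₀ ξ v` off `ramH (ρ(ξ)) ⊇ ram₀ ξ`,
the transported packet e.v.p. `evpH (ρ(ξ)) v` is the eigencharacter of an admissible unitarizable `K_v`-spherical class of `G′_v` — the text of `OverrideWitness.anchorH`
at `ρ = ρXi ξ`. [cite: Rogawski1990, §13.7 p. 210; §13.1 Prop. 13.1.3 p. 199; §4.13 Lemma 4.13.1] [cite: CartierCorvallis1979, §IV.1 Cor. 4.1–4.2] -/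
theorem anchorH_at_ρXiSC (hXU : XiLocalPacketUnitary L H hH hHd μω hμu μZ keys)
    (hμv : ∀ v : Places L, letI : MeasurableSpace ((cmDatum L 3 H).Local v) := borel _; (μv v).IsHaarMeasure)
    (hE : ∀ (ξ : OneDimAutRepH L) (v : Places L), v ∉ ramH (ρXi ξ) →
      evpH (ρXi ξ) v = (xiSideOfRecordSC L H hH hHd μω hμu μZ keys hSC hexc μv evpG evpH ramG ramH PiXi ρXi).tXi ξ v)
    (hR : ∀ ξ : OneDimAutRepH L, (xiSideOfRecordSC L H hH hHd μω hμu μZ keys hSC hexc μv evpG evpH ramG ramH PiXi ρXi).ram ξ ⊆ ramH (ρXi ξ))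
    (ξ : OneDimAutRepH L) (v : Places L) (hv : v ∉ ramH (ρXi ξ)) :
    letI : MeasurableSpace ((cmDatum L 3 H).Local v) := borel _
    ∃ π : IrrClass ((cmDatum L 3 H).Local v), π.IsAdmissible ∧ π.IsUnitarizable ∧
      π.IsSphericalWith (cmLocalIntegralLevel L 3 H v) (μv v) (evpH (ρXi ξ) v) := by
  rw [hE ξ v hv]
  exact ⟨_, anchorXi_xiSideOfRecordSC L H hH hHd μω hμu μZ keys hSC hexc μv evpG evpH ramG ramH PiXi ρXi hXU hμv ξ v
    (fun h => hv (hR ξ h))⟩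

end Bundle

end Summit.HodgeConjecture.HodgeConjecture.Cruxes.H413.F0P3Rung0EndoscopicAnchorSC

end
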